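import Literature.NumberTheory.GaloisRepresentations.ContinuousH1TrivialAction
import Literature.NumberTheory.GaloisRepresentations.ContinuousCohomologyConnecting
import Literature.NumberTheory.GaloisRepresentations.ContinuousRep
import HarnessLib

/-!
# LP-D (abstract core): the subgroup of `H¹(G, X)` of classes whose cocycles die on `J` under an
# invariant functional `s`, and its INDEX (cell `b2b-bsdres`, unit `b2b-bsdres-eisenstein-p1`,
# gen 20; X1R0-GAPMAP §28.4 (LP-D), §29)

HONEST FRAMING (run/shared/lean/b2b/bsd-rank1-residual/, verbatim in every file): the goal of the
cell is to DELETE the COMBINATION-SHAPED residual classes of the Birch–Swinnerton-Dyer formula for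
ALL analytic-rank `≤ 1` elliptic curves over `ℚ` — "full BSD formula for every rank `≤ 1` curve in
class `C`" assembled STRICTLY from published theorems — so that the rank-`≤ 1` remainder becomes
exactly the CONSTRUCTION-SHAPED classes, which are TYPED (missing-input `Prop`s), NOT attempted.
This is not "finishing BSD". Sub-cell `b2b-bsdres-eisenstein-p1`: research route; NO CLAIM BEYOND
STATED CLASSES; nothing here changes a label; nothing is booked. THEOREMS ONLY — pure (topological)
group cohomology in degree one, nothing about any curve or field.

## What and why

The local package at the prime `wp` of `ℚ_n` above `p` (memo `V76-LOCAL-TERM-PLAN.md` §5.2, LP-D)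
needs a subgroup `𝓛` of `H = H¹(Γ_L, E[p])` of controlled index whose classes are STRICT: every
cocycle `ψ` of the class has `s(ψ(g)) = 0` for all `g ∈ J`, where `s = red ∘ pointsMap` (reduction
of `p`-torsion points, `X1/LocalReductionStrict`) is a homomorphism to a finite group `A₀` (the
reductions `Ẽ[p]`) INVARIANT under the action (`s(g·Q) = s(Q)`: at an anomalous prime the local
Galois group fixes `Ẽ[p]`), and `J = I_L ∩ res⁻¹(Gal(\bar ℚ_n/ℚ_{n,∞}))`. Abstractly: `G` a
topological group, `X` a topological `ℤ[G]`-module, `s : X →+ A₀` continuous with `s ∘ ρ(g) = s`,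
`J ≤ G` (`A₀` with any topology making `s` continuous — the discrete one in practice). Then `ψ ↦ s ∘ ψ` sends continuous crossed homomorphisms of `X` to continuous HOMOMORPHISMS
`G → A₀` (= cocycles `Z¹(G, A₀)` of the trivial module), kills coboundaries, hence descends to
`Ψ : H →+ Z¹(G, A₀)`; with `res_J : Z¹(G, A₀) → (J → A₀)`:

* `exists_addSubgroup_strict` — **`𝓛 := ker(res_J ∘ Ψ)` is EXACTLY the set of strict classes, and
  `#H · #{f ∈ Z¹(G, A₀) | f(J) = 0} ≤ #𝓛 · #Z¹(G, A₀)`** (`[H : 𝓛] = #im(res_J ∘ Ψ) ≤ #im res_J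
  = #Z¹(G,A₀) / #ker res_J`).

The two remaining inputs of LP-D are thus isolated: `#Z¹(Γ_L, A₀) = #Hom_cont(Γ_L, ℤ/p)` (local
Euler–Poincaré characteristic + local duality in bidegree `(2,0)`) and
`#{f | f(J) = 0} ≥ p²` (an unramified and a cyclotomic character).

References: [SerreGaloisCohomology1997] I §2.2–§2.4, I §5.1; [NeukirchSchmidtWingberg2008] (1.6.6);
[GreenbergLNM1716] §2 pp. 70–75, §3 Lemma 3.4.
-/

noncomputable section

open scoped Classical
open Function CategoryTheory
open Literature.NumberTheory.GaloisRepresentations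

universe u

set_option autoImplicit false

namespace Summit.BirchSwinnertonDyer.Rank1Residual.X1.StrictClassesIndex

open _root_.TopRep _root_.ContinuousCohomology

variable {G : Type u} [Group G] [TopologicalSpace G] [IsTopologicalGroup G] (X : TopRep.{u} ℤ G)
  {A₀ : Type u} [AddCommGroup A₀] [TopologicalSpace A₀]
  (s : X →+ A₀) (hsc : Continuous s) (hs : ∀ (g : G) (x : X), s (X.ρ g x) = s x)

/-! ## §1. `ψ ↦ s ∘ ψ`: crossed homomorphisms of `X` to homomorphisms `G → A₀` -/

variable [IsTopologicalAddGroup A₀]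

omit [IsTopologicalGroup G] in
include hs in
/-- For `s` invariant (`s ∘ ρ(g) = s`) and a continuous crossed homomorphism `ψ` of `X`, the map
`s ∘ ψ : G → A₀` is a continuous crossed homomorphism of the TRIVIAL module `A₀`, i.e. a continuous
homomorphism. [cite: SerreGaloisCohomology1997, I §2.3] -/
theorem comp_mem_contOneCocycles (ψ : contOneCocycles X) :
    (⟨s ∘ ψ.1, hsc.comp ψ.1.continuous⟩ : C(G, A₀)) ∈
      contOneCocycles (ContinuousRep.trivial G ℤ A₀).toTopRep := by
  intro g h
  change s (ψ.1 (g * h)) = s (ψ.1 g) + (ContinuousRep.trivial G ℤ A₀).toTopRep.ρ g (s (ψ.1 h))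
  rw [ContinuousRep.toTopRep_ρ_apply, ContinuousRep.trivial_apply, ψ.2 g h, map_add, hs]

omit [TopologicalSpace A₀] [IsTopologicalAddGroup A₀] in
include hs in
/-- `s ∘ ψ` depends only on the class of `ψ`: coboundaries `g ↦ ρ(g)v − v` die under the invariant
`s`. [cite: SerreGaloisCohomology1997, I §2.2] -/
theorem apply_cocycle_eq_of_oneCocycleClass_eq (ψ ψ' : contOneCocycles X)
    (h : oneCocycleClass X ψ = oneCocycleClass X ψ') (g : G) : s (ψ.1 g) = s (ψ'.1 g) := by
  have h0 : oneCocycleClass X (ψ - ψ') = 0 := by rw [oneCocycleClass_sub, h, sub_self]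
  obtain ⟨v, hv⟩ := (oneCocycleClass_eq_zero_iff X _).mp h0
  have h1 : ψ.1 g = ψ'.1 g + (ψ - ψ').1 g := by
    change ψ.1 g = ψ'.1 g + (ψ.1 - ψ'.1) g
    rw [ContinuousMap.sub_apply, add_sub_cancel]
  rw [h1, hv g, map_add, map_sub, hs, sub_self, add_zero]

/-! ## §2. The subgroup of strict classes and its index -/

include hsc hs in
/-- **The strict classes form a subgroup `𝓛` of `H¹(G, X)` with
`#H¹(G, X) · #{f ∈ Z¹(G, A₀) | f(J) = 0} ≤ #𝓛 · #Z¹(G, A₀)`.** Here a class is STRICT when every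
continuous crossed homomorphism representing it is killed by `s` on `J`; `Z¹(G, A₀)` is the group of
continuous crossed homomorphisms of the trivial module `A₀` (= continuous homomorphisms `G → A₀`).
Proof: `ψ ↦ s ∘ ψ` descends to `Ψ : H¹(G, X) →+ Z¹(G, A₀)`; `𝓛 = ker(res_J ∘ Ψ)`;
`[H¹ : 𝓛] = #im(res_J ∘ Ψ) ≤ #im(res_J) = #Z¹(G, A₀)/#ker(res_J)`.
[cite: SerreGaloisCohomology1997, I §2.3, I §5.1] [cite: GreenbergLNM1716, §3 Lemma 3.4] -/
theorem exists_addSubgroup_strict (J : Subgroup G) [Finite (continuousCohomology 1 X)]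
    [Finite (contOneCocycles (ContinuousRep.trivial G ℤ A₀).toTopRep)] :
    ∃ 𝓛 : AddSubgroup (continuousCohomology 1 X),
      (∀ c, c ∈ 𝓛 ↔
        ∀ ψ : contOneCocycles X, oneCocycleClass X ψ = c → ∀ g ∈ J, s (ψ.1 g) = 0) ∧
      Nat.card (continuousCohomology 1 X) *
          Nat.card {f : contOneCocycles (ContinuousRep.trivial G ℤ A₀).toTopRep //
            ∀ g ∈ J, f.1 g = 0} ≤
        Nat.card 𝓛 * Nat.card (contOneCocycles (ContinuousRep.trivial G ℤ A₀).toTopRep) := by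
  -- `Ψ₀ : ψ ↦ s ∘ ψ`
  let Ψ₀ : contOneCocycles X →+ contOneCocycles (ContinuousRep.trivial G ℤ A₀).toTopRep :=
    { toFun := fun ψ ↦ ⟨⟨s ∘ ψ.1, hsc.comp ψ.1.continuous⟩, comp_mem_contOneCocycles X s hsc hs ψ⟩
      map_zero' := by
        apply Subtype.ext; ext g
        change s ((0 : contOneCocycles X).1 g) = 0
        rw [Submodule.coe_zero, ContinuousMap.zero_apply, map_zero]
      map_add' := fun a b ↦ by
        apply Subtype.ext; ext g
        change s ((a + b).1 g) = s (a.1 g) + s (b.1 g)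
        rw [Submodule.coe_add, ContinuousMap.add_apply, map_add] }
  have hΨ₀ : ∀ ψ g, (Ψ₀ ψ).1 g = s (ψ.1 g) := fun _ _ ↦ rfl
  have hΨ₀_wd : ∀ ψ ψ' : contOneCocycles X, oneCocycleClass X ψ = oneCocycleClass X ψ' →
      Ψ₀ ψ = Ψ₀ ψ' := fun ψ ψ' h ↦ by
    apply Subtype.ext; ext g
    rw [hΨ₀, hΨ₀]
    exact apply_cocycle_eq_of_oneCocycleClass_eq X s hs ψ ψ' h g
  -- descend to classes through chosen representatives
  have hsurj := oneCocycleClass_surjective X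
  let rep : continuousCohomology 1 X → contOneCocycles X := fun c ↦ (hsurj c).choose
  have hrep : ∀ c, oneCocycleClass X (rep c) = c := fun c ↦ (hsurj c).choose_spec
  let Ψ : continuousCohomology 1 X →+ contOneCocycles (ContinuousRep.trivial G ℤ A₀).toTopRep :=
    { toFun := fun c ↦ Ψ₀ (rep c)
      map_zero' := by
        rw [hΨ₀_wd (rep 0) 0 (by rw [hrep, oneCocycleClass_zero]), map_zero]
      map_add' := fun c c' ↦ by
        rw [hΨ₀_wd (rep (c + c')) (rep c + rep c')
          (by rw [hrep, oneCocycleClass_add, hrep, hrep]), map_add] }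
  have hΨ : ∀ ψ, Ψ (oneCocycleClass X ψ) = Ψ₀ ψ := fun ψ ↦ hΨ₀_wd _ _ (hrep _)
  -- restriction to `J`
  let resJ : contOneCocycles (ContinuousRep.trivial G ℤ A₀).toTopRep →+ (J → A₀) :=
    { toFun := fun f g ↦ f.1 g, map_zero' := rfl, map_add' := fun _ _ ↦ rfl }
  have hresJ_ker : ∀ f, f ∈ resJ.ker ↔ ∀ g ∈ J, f.1 g = 0 := fun f ↦ by
    rw [AddMonoidHom.mem_ker]
    constructor
    · intro h g hg; exact congr_fun h ⟨g, hg⟩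
    · intro h; funext g; exact h g g.2
  refine ⟨(resJ.comp Ψ).ker, fun c ↦ ?_, ?_⟩
  · rw [AddMonoidHom.mem_ker]
    constructor
    · intro hc ψ hψ g hg
      subst hψ
      have h2 := congr_fun hc ⟨g, hg⟩
      change (Ψ (oneCocycleClass X ψ)).1 g = 0 at h2
      rwa [hΨ, hΨ₀] at h2
    · intro hc
      obtain ⟨ψ, rfl⟩ := hsurj c
      funext g
      change (Ψ (oneCocycleClass X ψ)).1 g = 0
      rw [hΨ, hΨ₀]
      exact hc ψ rfl g g.2
  · -- the index count
    have hle : (resJ.comp Ψ).range ≤ resJ.range := by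
      rintro _ ⟨c, rfl⟩; exact ⟨Ψ c, rfl⟩
    haveI : Finite resJ.range := Finite.of_surjective resJ.rangeRestrict resJ.rangeRestrict_surjective
    have h1 : Nat.card (continuousCohomology 1 X) =
        Nat.card (resJ.comp Ψ).ker * Nat.card (resJ.comp Ψ).range := by
      rw [AddSubgroup.card_eq_card_quotient_mul_card_addSubgroup (resJ.comp Ψ).ker, mul_comm,
        Nat.card_congr (QuotientAddGroup.quotientKerEquivRange (resJ.comp Ψ)).toEquiv]
    have h2 : Nat.card (contOneCocycles (ContinuousRep.trivial G ℤ A₀).toTopRep) =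
        Nat.card resJ.ker * Nat.card resJ.range := by
      rw [AddSubgroup.card_eq_card_quotient_mul_card_addSubgroup resJ.ker, mul_comm,
        Nat.card_congr (QuotientAddGroup.quotientKerEquivRange resJ).toEquiv]
    have h3 : Nat.card (resJ.comp Ψ).range ≤ Nat.card resJ.range :=
      Nat.card_le_card_of_injective _ (AddSubgroup.inclusion_injective hle)
    have h4 : Nat.card {f : contOneCocycles (ContinuousRep.trivial G ℤ A₀).toTopRep //
        ∀ g ∈ J, f.1 g = 0} = Nat.card resJ.ker :=
      Nat.card_congr (Equiv.subtypeEquivRight fun f ↦ (hresJ_ker f).symm)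
    rw [h1, h2, h4]
    calc Nat.card (resJ.comp Ψ).ker * Nat.card (resJ.comp Ψ).range * Nat.card resJ.ker
        ≤ Nat.card (resJ.comp Ψ).ker * Nat.card resJ.range * Nat.card resJ.ker := by
          gcongr
      _ = Nat.card (resJ.comp Ψ).ker * (Nat.card resJ.ker * Nat.card resJ.range) := by ring

/-! ## §3. Two independent characters killing `J` give `#{f | f(J) = 0} ≥ p²` -/

omit [IsTopologicalGroup G] in
/-- **Two independent continuous homomorphisms `χ₁, χ₂ : G → A₀` vanishing on `J` give `p²`
distinct elements `a χ₁ + b χ₂` (`0 ≤ a, b < p`) of `{f ∈ Z¹(G, A₀) | f(J) = 0}`** — the shape in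
which the unramified character and the cyclotomic character of the local field enter LP-D.
[cite: GreenbergLNM1716, §3 Lemma 3.4] -/
theorem sq_le_natCard_subtype_forall_eq_zero {p : ℕ} (J : Subgroup G)
    [Finite (contOneCocycles (ContinuousRep.trivial G ℤ A₀).toTopRep)]
    (χ₁ χ₂ : contOneCocycles (ContinuousRep.trivial G ℤ A₀).toTopRep)
    (h₁ : ∀ g ∈ J, χ₁.1 g = 0) (h₂ : ∀ g ∈ J, χ₂.1 g = 0)
    (hindep : ∀ a b : ℤ, (∀ g : G, a • χ₁.1 g + b • χ₂.1 g = 0) → (p : ℤ) ∣ a ∧ (p : ℤ) ∣ b) :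
    p ^ 2 ≤ Nat.card {f : contOneCocycles (ContinuousRep.trivial G ℤ A₀).toTopRep //
      ∀ g ∈ J, f.1 g = 0} := by
  let F : Fin p × Fin p → {f : contOneCocycles (ContinuousRep.trivial G ℤ A₀).toTopRep //
      ∀ g ∈ J, f.1 g = 0} := fun ab ↦
    ⟨((ab.1 : ℕ) : ℤ) • χ₁ + ((ab.2 : ℕ) : ℤ) • χ₂, fun g hg ↦ by
      change ((ab.1 : ℕ) : ℤ) • χ₁.1 g + ((ab.2 : ℕ) : ℤ) • χ₂.1 g = 0
      rw [h₁ g hg, h₂ g hg, smul_zero, smul_zero, add_zero]⟩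
  have hF : Function.Injective F := by
    rintro ⟨a, b⟩ ⟨a', b'⟩ h
    have h' : ∀ g : G, (((a : ℕ) : ℤ) - a') • χ₁.1 g + (((b : ℕ) : ℤ) - b') • χ₂.1 g = 0 := by
      intro g
      have hg := congrArg
        (fun f : {f : contOneCocycles (ContinuousRep.trivial G ℤ A₀).toTopRep //
          ∀ g ∈ J, f.1 g = 0} ↦ f.1.1 g) h
      change ((a : ℕ) : ℤ) • χ₁.1 g + ((b : ℕ) : ℤ) • χ₂.1 g =
        ((a' : ℕ) : ℤ) • χ₁.1 g + ((b' : ℕ) : ℤ) • χ₂.1 g at hg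
      rw [sub_smul, sub_smul, ← sub_eq_zero.mpr hg]
      abel
    obtain ⟨ha, hb⟩ := hindep _ _ h'
    have ha2 := a.2; have ha2' := a'.2; have hb2 := b.2; have hb2' := b'.2
    have hsa : (((a : ℕ) : ℤ) - a') = 0 :=
      Int.eq_zero_of_dvd_of_natAbs_lt_natAbs ha (by omega)
    have hsb : (((b : ℕ) : ℤ) - b') = 0 :=
      Int.eq_zero_of_dvd_of_natAbs_lt_natAbs hb (by omega)
    have hab1 : a = a' := Fin.ext (by omega)
    have hab2 : b = b' := Fin.ext (by omega)
    rw [hab1, hab2]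
  calc p ^ 2 = Nat.card (Fin p × Fin p) := by
        rw [Nat.card_prod, Nat.card_eq_fintype_card, Fintype.card_fin, sq]
    _ ≤ _ := Nat.card_le_card_of_injective F hF

end Summit.BirchSwinnertonDyer.Rank1Residual.X1.StrictClassesIndex

end
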